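import Literature.Topology.FourManifolds.GluckDissolveGlued
import Literature.Topology.FourManifolds.NeckConnectedSum
import Literature.Topology.FourManifolds.SmoothEmbeddingCriteria
import HarnessLib

/-!
# The glued manifold of the dissolution is a connected sum with `ℂℙ²` (assembly lemma)

Let `M = ν.Dissolve` be the manifold `(S⁴ ∖ ν(S² × B̄(0,1))) ∪_τ Ṽ` of `GluckDissolveGlued.lean`.
This file proves the **assembly lemma** `TwoKnot.TubularNbhd.DissolveSide.isConnectedSum`: whenever

* a 4-manifold `Y` is an open gluing of the knot complement `S⁴ ∖ K(S²)` and `B = S² × ℝ²`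
  along a relation `jA a = jB b ↔ b.2 ≠ 0 ∧ a = μ (T b)` (`μ : B → S⁴` injective, `T : B → B`
  fibre-norm preserving) — e.g. the Gluck twist `Σ_K` (`μ = ν`, `T = τ`) or `S⁴` itself — and
* `M` is an open gluing of its piece `A` and the toric model `Ṽ` through an open smooth
  embedding `j : Ṽ → M` along `inl a = j v ↔ ∃ b, ‖b.2‖ > 1 ∧ v = toModel b ∧ a = μ (T b)`
  (e.g. `j = inr`, or `j = inr ∘ Ψ`),

then `M` is a connected sum `Y # ℂℙ²` in the sense of the tree's relational
`Literature.Topology.FourManifolds.IsConnectedSum`. The proof is the neck recognition principle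
`Literature.Topology.FourManifolds.isConnectedSum_of_neck` (`NeckConnectedSum.lean`, Kosinski VI §1) applied to the
neck `j ∘ neckV` of the toric model (`ToricBlowupNeck.lean`): the first summand `Y ∖ {jB p}`
embeds by `inl` on `jA(A)` and by `j ∘ toModel ∘ ΘB ∘ jB⁻¹` on `jB(B ∖ {p})` (the radial expansion
`ΘB` opening the puncture; the two agree on the overlap because `ΘB` is the identity on the end),
the second summand `ℂℙ² ∖ {q}` embeds by `j ∘ eTwo` (the squeezed tubular neighbourhood of the
exceptional curve), and the two images are separated by the middle sphere of blow-down radius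
`1/8`. The two applications (to `Σ_K` and to `S⁴`) are in `GluckDissolve.lean`.
-/

noncomputable section

open scoped Manifold ContDiff Topology
open Set Function Metric Module
open _root_.Topology

namespace Literature.Topology.FourManifolds

/-- Local notation: `𝔼 n` is the model Euclidean space `EuclideanSpace ℝ (Fin n)`. -/
local notation "𝔼 " n:arg => EuclideanSpace ℝ (Fin n)

/-- Local notation: `𝕊 n` is the unit sphere in `EuclideanSpace ℝ (Fin (n + 1))`. -/
local notation "𝕊 " n:arg => (Metric.sphere (0 : EuclideanSpace ℝ (Fin (n + 1))) 1)

open ToricBlowup SphereCoord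

namespace TwoKnot.TubularNbhd

variable {K : TwoKnot} (ν : TwoKnot.TubularNbhd K)

/-- **Data of one side of the dissolution.** A 4-manifold `Y` glued from the knot complement and
`B = S² × ℝ²` along `jA a = jB b ↔ b.2 ≠ 0 ∧ a = μ (T b)`, and an open smooth embedding
`j : Ṽ → M` presenting `M = ν.Dissolve` as the gluing of its piece `A` with `Ṽ` along
`inl a = j v ↔ ∃ b, ‖b.2‖ > 1 ∧ v = toModel b ∧ a = μ (T b)`. [folklore] -/
structure DissolveSide (Y : Type) [TopologicalSpace Y] [ChartedSpace (𝔼 4) Y] where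
  /-- The embedding of the knot complement. -/
  jA : K.complement → Y
  /-- The embedding of `B = S² × ℝ²`. -/
  jB : (𝕊 2) × 𝔼 2 → Y
  /-- The tube map of the relation (`ν` or its untwisted variant). -/
  μ : (𝕊 2) × 𝔼 2 → 𝕊 4
  /-- The twist of the relation (`gluckMap` or the identity). -/
  T : (𝕊 2) × 𝔼 2 → (𝕊 2) × 𝔼 2
  /-- The embedding of the toric model into `M`. -/
  j : Model → ν.Dissolve
  hjA : Manifold.IsSmoothEmbedding (𝓡 4) (𝓡 4) ∞ jA
  hjAo : IsOpen (range jA)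
  hjB : Manifold.IsSmoothEmbedding ((𝓡 2).prod 𝓘(ℝ, 𝔼 2)) (𝓡 4) ∞ jB
  hjBo : IsOpen (range jB)
  hcov : range jA ∪ range jB = univ
  hT : ∀ b, (T b).2 = b.2
  hTsurj : ∀ b : (𝕊 2) × 𝔼 2, b.2 ≠ 0 → ∃ b', T b' = b
  hrel : ∀ a b, jA a = jB b ↔ b.2 ≠ 0 ∧ (a : 𝕊 4) = μ (T b)
  hμinj : Injective μ
  hμ0 : ∀ x, μ (x, 0) ∈ range K
  hμK : ∀ b : (𝕊 2) × 𝔼 2, b.2 ≠ 0 → μ b ∉ range K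
  hμA : ∀ a : K.complement, a ∈ ν.dissolveA ↔ (a : 𝕊 4) ∉ μ '' (univ ×ˢ closedBall (0 : 𝔼 2) 1)
  hj : Manifold.IsSmoothEmbedding 𝓘(ℝ, ℂ × ℂ) (𝓡 4) ∞ j
  hjo : IsOpen (range j)
  hjcov : range ν.dissolveData.inl ∪ range j = univ
  hjrel : ∀ a v, ν.dissolveData.inl a = j v ↔
    ∃ b ∈ endB, v = toModel b ∧ ((a : K.complement) : 𝕊 4) = μ (T b)

namespace DissolveSide

variable {ν}
variable {Y : Type} [TopologicalSpace Y] [ChartedSpace (𝔼 4) Y] (S : DissolveSide ν Y)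

/-! ### Elementary consequences of the relations -/

/-- `jA a = jB b` with `a ∈ A` forces `‖b.2‖ > 1`. [folklore] -/
theorem one_lt_of_rel {a : K.complement} {b : (𝕊 2) × 𝔼 2} (ha : a ∈ ν.dissolveA) (h : S.jA a = S.jB b) :
    1 < ‖b.2‖ := by
  obtain ⟨hb, hab⟩ := (S.hrel a b).1 h
  have ha' := (S.hμA a).1 ha
  by_contra hle
  push Not at hle
  apply ha'
  rw [hab]
  exact ⟨S.T b, ⟨mem_univ _, by rw [mem_closedBall, dist_zero_right, S.hT]; exact hle⟩, rfl⟩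

/-- For `b` in the end, `μ (T b)` is a point of `A`. [folklore] -/
theorem mem_dissolveA_of_endB {b : (𝕊 2) × 𝔼 2} (hb : b ∈ endB) :
    ∃ a : K.complement, a ∈ ν.dissolveA ∧ (a : 𝕊 4) = S.μ (S.T b) := by
  have hb0 : (S.T b).2 ≠ 0 := by rw [S.hT]; exact snd_ne_zero_of_mem_endB hb
  have hK : S.μ (S.T b) ∈ K.complement := by
    rw [SphereEmbedding.mem_complement_iff]; exact S.hμK _ hb0
  refine ⟨⟨_, hK⟩, ?_, rfl⟩
  rw [S.hμA]
  rintro ⟨b', ⟨-, hb'⟩, hbb'⟩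
  have := S.hμinj hbb'
  rw [this, mem_closedBall, dist_zero_right, S.hT] at hb'
  exact not_le.2 hb hb'

/-- `jB b` for `b` in the end is `jA` of a point of `A`. [folklore] -/
theorem jB_eq_jA_of_endB {b : (𝕊 2) × 𝔼 2} (hb : b ∈ endB) :
    ∃ a : K.complement, a ∈ ν.dissolveA ∧ S.jA a = S.jB b := by
  obtain ⟨a, ha, hab⟩ := S.mem_dissolveA_of_endB hb
  exact ⟨a, ha, (S.hrel a b).2 ⟨snd_ne_zero_of_mem_endB hb, hab⟩⟩

/-- A point of `Y` other than `jB p` is in `jB (B ∖ {p})` or in `jA (A)`. [folklore] -/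
theorem exists_eq_of_ne {y : Y} (hy : y ≠ S.jB ToricBlowup.basePt) :
    (∃ b ≠ ToricBlowup.basePt, S.jB b = y) ∨ ∃ a ∈ ν.dissolveA, S.jA a = y := by
  rcases (eq_univ_iff_forall.1 S.hcov y) with ⟨a, rfl⟩ | ⟨b, rfl⟩
  · by_cases ha : a ∈ ν.dissolveA
    · exact Or.inr ⟨a, ha, rfl⟩
    · left
      rw [S.hμA, not_not] at ha
      obtain ⟨b₁, ⟨-, hb₁⟩, hab⟩ := ha
      have hb0 : b₁.2 ≠ 0 := by
        rintro h0
        obtain ⟨x, w⟩ := b₁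
        change w = 0 at h0; subst h0
        exact (SphereEmbedding.mem_complement_iff K a).1 a.2 (hab ▸ S.hμ0 x)
      obtain ⟨b, rfl⟩ := S.hTsurj b₁ hb0
      have hb0' : b.2 ≠ 0 := by rw [← S.hT]; exact hb0
      refine ⟨b, ?_, ((S.hrel a b).2 ⟨hb0', hab.symm⟩).symm⟩
      rintro rfl; exact hb0' rfl
  · exact Or.inl ⟨b, fun h => hy (h ▸ rfl), rfl⟩

/-! ### The two partial diffeomorphisms presenting the first summand -/

/-- Nonemptiness of `B`. [folklore] -/
instance : Nonempty ((𝕊 2) × 𝔼 2) := ⟨ToricBlowup.basePt⟩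

/-- Nonemptiness of the toric model. [folklore] -/
instance : Nonempty Model := ⟨Φ₁ 0⟩

/-- Nonemptiness of the knot complement (it contains the end of the tube). [folklore] -/
theorem nonempty_complement_of (ν : TwoKnot.TubularNbhd K) : Nonempty K.complement :=
  ⟨((Classical.choice (inferInstance : Nonempty ν.dissolveA) : ν.dissolveA) : K.complement)⟩

/-- The chart of the open embedding `jB`. [folklore] -/
def jBc : OpenPartialHomeomorph ((𝕊 2) × 𝔼 2) Y := openEmbeddingChart S.hjB S.hjBo

/-- The chart of the open embedding `jA`. [folklore] -/
def jAc : OpenPartialHomeomorph K.complement Y :=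
  haveI := nonempty_complement_of ν
  openEmbeddingChart S.hjA S.hjAo

/-- The chart of the open embedding `j`. [folklore] -/
def jc : OpenPartialHomeomorph Model ν.Dissolve := openEmbeddingChart S.hj S.hjo

/-- The chart of the open embedding `inl : A → M`. [folklore] -/
def ic : OpenPartialHomeomorph ν.dissolveA ν.Dissolve :=
  openEmbeddingChart ν.dissolveData.isSmoothEmbedding_inl ν.dissolveData.isOpen_range_inl

/-- The coercion chart `A ⇀ (knot complement)`. [folklore] -/
def Ac : OpenPartialHomeomorph ν.dissolveA K.complement :=
  ν.dissolveA.openPartialHomeomorphSubtypeCoe inferInstance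

/-- **The `B`-part of the first embedding**: `jB b ↦ j (toModel (ΘB b))`. [folklore] -/
def EB : OpenPartialHomeomorph Y ν.Dissolve := (S.jBc.symm.trans ΘBPH).trans (toModelPH.trans S.jc)

/-- **The `A`-part of the first embedding**: `jA a ↦ inl a`. [folklore] -/
def EA : OpenPartialHomeomorph Y ν.Dissolve := (S.jAc.symm.trans (Ac (ν := ν)).symm).trans ic

/-- `EB (jB b) = j (toModel (ΘB b))`. [folklore] -/
theorem EB_apply (b : (𝕊 2) × 𝔼 2) : S.EB (S.jB b) = S.j (toModel (ΘB b)) := by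
  simp [EB, jBc, jc, openEmbeddingChart_symm_apply]

/-- The source of `EB` is `jB (B ∖ {p})`. [folklore] -/
theorem mem_EB_source_iff (y : Y) : y ∈ S.EB.source ↔ ∃ b ≠ ToricBlowup.basePt, S.jB b = y := by
  constructor
  · intro hy
    have h1 : y ∈ S.jBc.symm.source := hy.1.1
    rw [OpenPartialHomeomorph.symm_source, jBc, openEmbeddingChart_target] at h1
    obtain ⟨b, rfl⟩ := h1
    refine ⟨b, ?_, rfl⟩
    have h2 := hy.1.2
    simp only [mem_preimage, ΘBPH_source, mem_setOf_eq, jBc, OpenPartialHomeomorph.symm_symm] at h2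
    rwa [show (openEmbeddingChart S.hjB S.hjBo).symm (S.jB b) = b from openEmbeddingChart_symm_apply _ _ b] at h2
  · rintro ⟨b, hb, rfl⟩
    refine ⟨⟨?_, ?_⟩, ?_⟩
    · change S.jB b ∈ S.jBc.target; rw [jBc, openEmbeddingChart_target]; exact mem_range_self b
    · change S.jBc.symm (S.jB b) ∈ ΘBPH.source
      rw [jBc, openEmbeddingChart_symm_apply]; exact hb
    · change ΘBPH (S.jBc.symm (S.jB b)) ∈ (toModelPH.trans S.jc).source
      rw [jBc, openEmbeddingChart_symm_apply, OpenPartialHomeomorph.trans_source, toModelPH_source, jc,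
        openEmbeddingChart_source, preimage_univ, inter_univ]
      exact ΘB_ne_basePt hb

/-- `EA (jA a) = inl a` for `a ∈ A`. [folklore] -/
theorem EA_apply {a : K.complement} (ha : a ∈ ν.dissolveA) : S.EA (S.jA a) = ν.dissolveData.inl ⟨a, ha⟩ := by
  haveI := nonempty_complement_of ν
  have h1 : S.jAc.symm (S.jA a) = a := openEmbeddingChart_symm_apply S.hjA S.hjAo a
  have h2 : (Ac (ν := ν)).symm a = ⟨a, ha⟩ := by
    apply Subtype.ext
    exact (Ac (ν := ν)).right_inv (show a ∈ (Ac (ν := ν)).target by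
      rw [Ac, TopologicalSpace.Opens.openPartialHomeomorphSubtypeCoe_target]; exact ha)
  change ic ((Ac (ν := ν)).symm (S.jAc.symm (S.jA a))) = _
  rw [h1, h2]
  rfl

/-- The source of `EA` is `jA (A)`. [folklore] -/
theorem mem_EA_source_iff (y : Y) : y ∈ S.EA.source ↔ ∃ a ∈ ν.dissolveA, S.jA a = y := by
  haveI := nonempty_complement_of ν
  constructor
  · intro hy
    have h1 : y ∈ S.jAc.symm.source := hy.1.1
    rw [OpenPartialHomeomorph.symm_source, jAc, openEmbeddingChart_target] at h1
    obtain ⟨a, rfl⟩ := h1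
    have h2 : S.jAc.symm (S.jA a) ∈ (Ac (ν := ν)).symm.source := hy.1.2
    have hsymm : S.jAc.symm (S.jA a) = a := openEmbeddingChart_symm_apply S.hjA S.hjAo a
    rw [hsymm, OpenPartialHomeomorph.symm_source, Ac,
      TopologicalSpace.Opens.openPartialHomeomorphSubtypeCoe_target] at h2
    exact ⟨a, h2, rfl⟩
  · rintro ⟨a, ha, rfl⟩
    refine ⟨⟨?_, ?_⟩, ?_⟩
    · change S.jA a ∈ S.jAc.target; rw [jAc, openEmbeddingChart_target]; exact mem_range_self a
    · change S.jAc.symm (S.jA a) ∈ (Ac (ν := ν)).symm.source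
      rw [jAc, openEmbeddingChart_symm_apply, OpenPartialHomeomorph.symm_source, Ac,
        TopologicalSpace.Opens.openPartialHomeomorphSubtypeCoe_target]
      exact ha
    · change (S.jAc.symm.trans (Ac (ν := ν)).symm) (S.jA a) ∈ (ic (ν := ν)).source
      rw [ic, openEmbeddingChart_source]; exact mem_univ _

/-- **The two parts agree on the overlap** (the end: there `ΘB = id` and the gluing relation of `M`
identifies `inl a` with `j (toModel b)`). [folklore] -/
theorem EA_eq_EB {y : Y} (hA : y ∈ S.EA.source) (hB : y ∈ S.EB.source) : S.EA y = S.EB y := by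
  obtain ⟨a, ha, rfl⟩ := (S.mem_EA_source_iff y).1 hA
  obtain ⟨b, hb, hab⟩ := (S.mem_EB_source_iff _).1 hB
  have h1 : 1 < ‖b.2‖ := S.one_lt_of_rel ha hab.symm
  rw [S.EA_apply ha, ← hab, S.EB_apply, ΘB_eq_self_of_norm_snd (le_of_lt (lt_of_le_of_lt (by norm_num) h1))]
  rw [S.hjrel]
  exact ⟨b, h1, rfl, ((S.hrel a b).1 hab.symm).2⟩

/-- `EB` is smooth on its source. [folklore] -/
theorem contMDiffOn_EB : ContMDiffOn (𝓡 4) (𝓡 4) ∞ S.EB S.EB.source :=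
  contMDiffOn_trans_of (contMDiffOn_trans_of (by
    simpa [jBc] using contMDiffOn_openEmbeddingChart_symm S.hjB S.hjBo) contMDiffOn_ΘBPH)
    (contMDiffOn_trans_of contMDiffOn_toModelPH (contMDiffOn_openEmbeddingChart S.hj S.hjo))

/-- `EB.symm` is smooth on its target. [folklore] -/
theorem contMDiffOn_EB_symm : ContMDiffOn (𝓡 4) (𝓡 4) ∞ S.EB.symm S.EB.target :=
  contMDiffOn_trans_symm_of (contMDiffOn_trans_symm_of (by
    simpa [jBc] using contMDiffOn_openEmbeddingChart S.hjB S.hjBo) contMDiffOn_ΘBPH_symm)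
    (contMDiffOn_trans_symm_of contMDiffOn_toModelPH_symm (contMDiffOn_openEmbeddingChart_symm S.hj S.hjo))

/-- `EA` is smooth on its source. [folklore] -/
theorem contMDiffOn_EA : ContMDiffOn (𝓡 4) (𝓡 4) ∞ S.EA S.EA.source :=
  haveI := nonempty_complement_of ν
  contMDiffOn_trans_of (contMDiffOn_trans_of (by
    simpa [jAc] using contMDiffOn_openEmbeddingChart_symm S.hjA S.hjAo) (by
    simpa [Ac] using contMDiffOn_openPartialHomeomorphSubtypeCoe_symm ν.dissolveA inferInstance))
    (contMDiffOn_openEmbeddingChart _ _)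

/-- `EA.symm` is smooth on its target. [folklore] -/
theorem contMDiffOn_EA_symm : ContMDiffOn (𝓡 4) (𝓡 4) ∞ S.EA.symm S.EA.target :=
  haveI := nonempty_complement_of ν
  contMDiffOn_trans_symm_of (contMDiffOn_trans_symm_of (by
    simpa [jAc] using contMDiffOn_openEmbeddingChart S.hjA S.hjAo) (by
    simpa [Ac] using contMDiffOn_openPartialHomeomorphSubtypeCoe ν.dissolveA inferInstance))
    (contMDiffOn_openEmbeddingChart_symm _ _)

/-! ### The first embedding -/

/-- The disc of `Y` at `jB p`: `c₁ = jB ∘ discB`. [folklore] -/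
def cOne (v : 𝔼 4) : Y := S.jB (discB v)

/-- `c₁` is injective. [folklore] -/
theorem cOne_injective : Injective S.cOne := fun _ _ h =>
  discB_injective (S.hjB.isEmbedding.injective h)

/-- `c₁ 0 = jB p`. [folklore] -/
@[simp] theorem cOne_zero : S.cOne 0 = S.jB ToricBlowup.basePt := by rw [cOne, discB_zero]

/-- The neck of `M`: `ψ = j ∘ neckV`, a smooth embedding. [folklore] -/
theorem isSmoothEmbedding_neck :
    Manifold.IsSmoothEmbedding ((𝓡 3).prod 𝓘(ℝ, ℝ)) (𝓡 4) ∞ (S.j ∘ neckV) := by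
  have L : (EuclideanSpace ℝ (Fin 3) × ℝ) ≃L[ℝ] 𝔼 4 := ContinuousLinearEquiv.ofFinrankEq (by simp)
  have h := isSmoothEmbedding_of_openPartialHomeomorph (I := (𝓡 3).prod 𝓘(ℝ, ℝ)) (J := 𝓡 4) (n := ∞)
    (neckVPH.trans S.jc) (by
      rw [OpenPartialHomeomorph.trans_source, neckVPH_source, univ_inter, jc, openEmbeddingChart_source,
        preimage_univ])
    (contMDiffOn_trans_of contMDiffOn_neckVPH (contMDiffOn_openEmbeddingChart S.hj S.hjo))
    (contMDiffOn_trans_symm_of contMDiffOn_neckVPH_symm (contMDiffOn_openEmbeddingChart_symm S.hj S.hjo)) L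
  exact h

section Embedding

variable [T2Space Y]

/-- **The first embedding** `Y ∖ {jB p} → M`: `EB` on `jB (B ∖ {p})`, `EA` on `jA (A)`. [folklore] -/
def eOne (y : puncture S.cOne) : ν.Dissolve :=
  open scoped Classical in
  if (y : Y) ∈ S.EB.source then S.EB y else S.EA y

/-- `e₁ = EB` on `EB.source`. [folklore] -/
theorem eOne_of_mem_EB {y : puncture S.cOne} (hy : (y : Y) ∈ S.EB.source) : S.eOne y = S.EB y := by
  rw [eOne, if_pos hy]

/-- `e₁ = EA` on `EA.source`. [folklore] -/
theorem eOne_of_mem_EA {y : puncture S.cOne} (hy : (y : Y) ∈ S.EA.source) : S.eOne y = S.EA y := by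
  by_cases hB : (y : Y) ∈ S.EB.source
  · rw [eOne_of_mem_EB S hB, S.EA_eq_EB hy hB]
  · rw [eOne, if_neg hB]

/-- Every point of `Y ∖ {jB p}` is in `EB.source` or `EA.source`. [folklore] -/
theorem mem_EB_source_or (y : puncture S.cOne) : (y : Y) ∈ S.EB.source ∨ (y : Y) ∈ S.EA.source := by
  have hy : (y : Y) ≠ S.jB ToricBlowup.basePt := by rw [← cOne_zero]; exact y.2
  rcases S.exists_eq_of_ne hy with h | h
  · exact Or.inl ((S.mem_EB_source_iff _).2 h)
  · exact Or.inr ((S.mem_EA_source_iff _).2 h)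

/-- `jB b ∈ Y ∖ {jB p}` for `b ≠ p`. [folklore] -/
theorem jB_mem_puncture {b : (𝕊 2) × 𝔼 2} (hb : b ≠ ToricBlowup.basePt) :
    S.jB b ∈ (puncture S.cOne : Set Y) := by
  rw [coe_puncture, mem_compl_iff, mem_singleton_iff, cOne_zero]
  exact fun h => hb (S.hjB.isEmbedding.injective h)

/-- `e₁ (jB b) = j (toModel (ΘB b))` for `b ≠ p`. [folklore] -/
theorem eOne_jB {b : (𝕊 2) × 𝔼 2} (hb : b ≠ ToricBlowup.basePt) :
    S.eOne ⟨S.jB b, S.jB_mem_puncture hb⟩ = S.j (toModel (ΘB b)) := by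
  rw [eOne_of_mem_EB S ((S.mem_EB_source_iff _).2 ⟨b, hb, rfl⟩)]
  exact S.EB_apply b

/-- **The range of `e₁`** is `inl (A) ∪ j (rangeOne)`. [folklore] -/
theorem mem_range_eOne_iff (m : ν.Dissolve) :
    m ∈ range S.eOne ↔ m ∈ range ν.dissolveData.inl ∨ ∃ v ∈ rangeOne, S.j v = m := by
  constructor
  · rintro ⟨y, rfl⟩
    rcases S.mem_EB_source_or y with hy | hy
    · obtain ⟨b, hb, hyb⟩ := (S.mem_EB_source_iff _).1 hy
      right
      refine ⟨toModel (ΘB b), toModel_ΘB_mem_rangeOne hb, ?_⟩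
      rw [eOne_of_mem_EB S hy, ← S.EB_apply b, hyb]
    · obtain ⟨a, ha, hya⟩ := (S.mem_EA_source_iff _).1 hy
      left
      refine ⟨⟨a, ha⟩, ?_⟩
      rw [eOne_of_mem_EA S hy, ← S.EA_apply ha, hya]
  · rintro (⟨⟨a, ha⟩, rfl⟩ | ⟨v, hv, rfl⟩)
    · have hmem : S.jA a ∈ (puncture S.cOne : Set Y) := by
        rw [coe_puncture, mem_compl_iff, mem_singleton_iff, cOne_zero]
        intro h
        have := S.one_lt_of_rel ha h
        simp [ToricBlowup.basePt] at this; norm_num at this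
      refine ⟨⟨S.jA a, hmem⟩, ?_⟩
      rw [eOne_of_mem_EA S ((S.mem_EA_source_iff _).2 ⟨a, ha, rfl⟩)]
      exact S.EA_apply ha
    · obtain ⟨b, hb, rfl⟩ := exists_eq_toModel_ΘB hv
      exact ⟨⟨S.jB b, S.jB_mem_puncture hb⟩, S.eOne_jB hb⟩

/-- `rangeOne` is the image of the target of `ΘBPH` under `toModel`; in particular it is open.
[folklore] -/
theorem isOpen_rangeOne : IsOpen rangeOne := by
  have h : rangeOne = toModel '' (ΘB '' {b | b ≠ ToricBlowup.basePt}) := by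
    ext v
    constructor
    · intro hv
      obtain ⟨b, hb, rfl⟩ := exists_eq_toModel_ΘB hv
      exact ⟨ΘB b, ⟨b, hb, rfl⟩, rfl⟩
    · rintro ⟨_, ⟨b, hb, rfl⟩, rfl⟩
      exact toModel_ΘB_mem_rangeOne hb
  rw [h, show ΘB '' {b | b ≠ ToricBlowup.basePt} = ΘBPH.target from ΘBPH.image_source_eq_target]
  refine isOpen_image_toModel ΘBPH.open_target ?_
  rw [ΘBPH_target, mem_compl_iff, not_not]
  exact ⟨0, by simp, discB_zero⟩

/-- The range of `e₁` is open. [folklore] -/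
theorem isOpen_range_eOne : IsOpen (range S.eOne) := by
  have h : range S.eOne = range ν.dissolveData.inl ∪ S.j '' rangeOne := by
    ext m; rw [mem_range_eOne_iff]; rfl
  rw [h]
  exact ν.dissolveData.isOpen_range_inl.union
    ((IsOpenEmbedding.mk S.hj.isEmbedding S.hjo).isOpenMap _ isOpen_rangeOne)

/-- **`e₁` is injective.** [folklore] -/
theorem eOne_injective : Injective S.eOne := by
  intro y y' h
  -- reduce to the values
  apply Subtype.ext
  rcases S.mem_EB_source_or y with hy | hy <;> rcases S.mem_EB_source_or y' with hy' | hy'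
  · rw [eOne_of_mem_EB S hy, eOne_of_mem_EB S hy'] at h
    exact S.EB.injOn hy hy' h
  · -- `EB y = EA y'`
    obtain ⟨b, hb, hyb⟩ := (S.mem_EB_source_iff _).1 hy
    obtain ⟨a, ha, hya⟩ := (S.mem_EA_source_iff _).1 hy'
    rw [eOne_of_mem_EB S hy, eOne_of_mem_EA S hy', ← hyb, ← hya, S.EB_apply, S.EA_apply ha, eq_comm,
      S.hjrel] at h
    obtain ⟨b₂, hb₂, h2, hab⟩ := h
    have hbb : ΘB b = b₂ :=
      toModel_injOn (ΘB_ne_basePt hb) (fun h => basePt_not_mem_endB (h ▸ hb₂)) h2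
    have hΘ : ΘB b₂ = b₂ := ΘB_eq_self_of_norm_snd (le_of_lt (lt_of_le_of_lt (by norm_num) hb₂))
    have hb₂p : b₂ ≠ ToricBlowup.basePt := fun h => basePt_not_mem_endB (h ▸ hb₂)
    have hb' : b = b₂ :=
      calc b = ΘBInv (ΘB b) := (ΘBInv_ΘB hb).symm
        _ = ΘBInv b₂ := by rw [hbb]
        _ = ΘBInv (ΘB b₂) := by rw [hΘ]
        _ = b₂ := ΘBInv_ΘB hb₂p
    rw [← hyb, ← hya, hb']
    exact ((S.hrel a b₂).2 ⟨snd_ne_zero_of_mem_endB hb₂, hab⟩).symm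
  · obtain ⟨b, hb, hyb⟩ := (S.mem_EB_source_iff _).1 hy'
    obtain ⟨a, ha, hya⟩ := (S.mem_EA_source_iff _).1 hy
    rw [eOne_of_mem_EB S hy', eOne_of_mem_EA S hy, ← hyb, ← hya, S.EB_apply, S.EA_apply ha,
      S.hjrel] at h
    obtain ⟨b₂, hb₂, h2, hab⟩ := h
    have hbb : ΘB b = b₂ :=
      toModel_injOn (ΘB_ne_basePt hb) (fun h => basePt_not_mem_endB (h ▸ hb₂)) h2
    have hΘ : ΘB b₂ = b₂ := ΘB_eq_self_of_norm_snd (le_of_lt (lt_of_le_of_lt (by norm_num) hb₂))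
    have hb₂p : b₂ ≠ ToricBlowup.basePt := fun h => basePt_not_mem_endB (h ▸ hb₂)
    have hb' : b = b₂ :=
      calc b = ΘBInv (ΘB b) := (ΘBInv_ΘB hb).symm
        _ = ΘBInv b₂ := by rw [hbb]
        _ = ΘBInv (ΘB b₂) := by rw [hΘ]
        _ = b₂ := ΘBInv_ΘB hb₂p
    rw [← hyb, ← hya, hb']
    exact (S.hrel a b₂).2 ⟨snd_ne_zero_of_mem_endB hb₂, hab⟩
  · rw [eOne_of_mem_EA S hy, eOne_of_mem_EA S hy'] at h
    exact S.EA.injOn hy hy' h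

/-- Nonemptiness of the punctured first summand. [folklore] -/
instance nonempty_puncture : Nonempty (puncture S.cOne) :=
  ⟨⟨S.cOne (EuclideanSpace.single 0 1), by
    rw [mem_puncture]; intro h; have := S.cOne_injective h; simp at this⟩⟩

/-- The local partial diffeomorphism of `e₁` at a point of `EB.source`: the coercion chart of the
open subset `Y ∖ {jB p}` followed by `EB`. [folklore] -/
def locB : OpenPartialHomeomorph (puncture S.cOne) ν.Dissolve :=
  ((puncture S.cOne).openPartialHomeomorphSubtypeCoe inferInstance).trans S.EB

/-- The local partial diffeomorphism of `e₁` at a point of `EA.source`. [folklore] -/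
def locA : OpenPartialHomeomorph (puncture S.cOne) ν.Dissolve :=
  ((puncture S.cOne).openPartialHomeomorphSubtypeCoe inferInstance).trans S.EA

/-- **`e₁` is a smooth immersion** (at every point it agrees with a partial diffeomorphism).
[folklore] -/
theorem isImmersionAt_eOne [IsManifold (𝓡 4) ∞ Y] (y : puncture S.cOne) :
    Manifold.IsImmersionAtOfComplement Unit (𝓡 4) (𝓡 4) ∞ S.eOne y := by
  have hcoe : ∀ z : puncture S.cOne, ((puncture S.cOne).openPartialHomeomorphSubtypeCoe inferInstance) z = (z : Y) :=
    fun z => rfl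
  rcases S.mem_EB_source_or y with hy | hy
  · have hsrc : y ∈ S.locB.source := by
      refine ⟨by simp, ?_⟩
      change ((puncture S.cOne).openPartialHomeomorphSubtypeCoe inferInstance) y ∈ S.EB.source
      rw [hcoe]; exact hy
    refine isImmersionAtOfComplement_of_eventuallyEq_openPartialHomeomorph S.locB
      (contMDiffOn_trans_of (contMDiffOn_openPartialHomeomorphSubtypeCoe _ _) S.contMDiffOn_EB)
      (contMDiffOn_trans_symm_of (contMDiffOn_openPartialHomeomorphSubtypeCoe_symm _ _) S.contMDiffOn_EB_symm)
      (ContinuousLinearEquiv.refl ℝ _) hsrc ?_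
    filter_upwards [S.locB.open_source.mem_nhds hsrc] with z hz
    have hz' : (z : Y) ∈ S.EB.source := by simpa [mem_preimage] using hz.2
    rw [eOne_of_mem_EB S hz']; rfl
  · have hsrc : y ∈ S.locA.source := by
      refine ⟨by simp, ?_⟩
      change ((puncture S.cOne).openPartialHomeomorphSubtypeCoe inferInstance) y ∈ S.EA.source
      rw [hcoe]; exact hy
    refine isImmersionAtOfComplement_of_eventuallyEq_openPartialHomeomorph S.locA
      (contMDiffOn_trans_of (contMDiffOn_openPartialHomeomorphSubtypeCoe _ _) S.contMDiffOn_EA)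
      (contMDiffOn_trans_symm_of (contMDiffOn_openPartialHomeomorphSubtypeCoe_symm _ _) S.contMDiffOn_EA_symm)
      (ContinuousLinearEquiv.refl ℝ _) hsrc ?_
    filter_upwards [S.locA.open_source.mem_nhds hsrc] with z hz
    have hz' : (z : Y) ∈ S.EA.source := by simpa [mem_preimage] using hz.2
    rw [eOne_of_mem_EA S hz']; rfl

/-- `e₁` is continuous. [folklore] -/
theorem continuous_eOne [IsManifold (𝓡 4) ∞ Y] : Continuous S.eOne :=
  continuous_iff_continuousAt.2 fun y => (S.isImmersionAt_eOne y).continuousAt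

/-- `e₁` is an open map (locally it is a partial homeomorphism). [folklore] -/
theorem isOpenMap_eOne : IsOpenMap S.eOne := by
  refine isOpenMap_iff_nhds_le.2 fun y => ?_
  have hcoe : ∀ z : puncture S.cOne, ((puncture S.cOne).openPartialHomeomorphSubtypeCoe inferInstance) z = (z : Y) :=
    fun z => rfl
  rcases S.mem_EB_source_or y with hy | hy
  · have hsrc : y ∈ S.locB.source := by
      refine ⟨by simp, ?_⟩
      change ((puncture S.cOne).openPartialHomeomorphSubtypeCoe inferInstance) y ∈ S.EB.source
      rw [hcoe]; exact hy
    have heq : S.eOne =ᶠ[𝓝 y] S.locB := by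
      filter_upwards [S.locB.open_source.mem_nhds hsrc] with z hz
      have hz' : (z : Y) ∈ S.EB.source := by simpa [mem_preimage] using hz.2
      rw [eOne_of_mem_EB S hz']; rfl
    rw [Filter.EventuallyEq.eq_of_nhds heq, Filter.map_congr heq]
    exact (S.locB.map_nhds_eq hsrc).ge
  · have hsrc : y ∈ S.locA.source := by
      refine ⟨by simp, ?_⟩
      change ((puncture S.cOne).openPartialHomeomorphSubtypeCoe inferInstance) y ∈ S.EA.source
      rw [hcoe]; exact hy
    have heq : S.eOne =ᶠ[𝓝 y] S.locA := by
      filter_upwards [S.locA.open_source.mem_nhds hsrc] with z hz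
      have hz' : (z : Y) ∈ S.EA.source := by simpa [mem_preimage] using hz.2
      rw [eOne_of_mem_EA S hz']; rfl
    rw [Filter.EventuallyEq.eq_of_nhds heq, Filter.map_congr heq]
    exact (S.locA.map_nhds_eq hsrc).ge

/-- **`e₁` is a smooth embedding.** [folklore] -/
theorem isSmoothEmbedding_eOne [IsManifold (𝓡 4) ∞ Y] : Manifold.IsSmoothEmbedding (𝓡 4) (𝓡 4) ∞ S.eOne :=
  ⟨Manifold.IsImmersionOfComplement.isImmersion S.isImmersionAt_eOne,
    (IsOpenEmbedding.of_continuous_injective_isOpenMap S.continuous_eOne S.eOne_injective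
      S.isOpenMap_eOne).isEmbedding⟩

/-! ### The other data of the neck presentation -/

omit [T2Space Y] in
/-- `c₁` is a smooth embedding `ℝ⁴ → Y`. [folklore] -/
theorem isSmoothEmbedding_cOne [IsManifold (𝓡 4) ∞ Y] : Manifold.IsSmoothEmbedding 𝓘(ℝ, 𝔼 4) (𝓡 4) ∞ S.cOne := by
  have h := isSmoothEmbedding_of_openPartialHomeomorph (I := 𝓘(ℝ, 𝔼 4)) (J := 𝓡 4) (n := ∞)
    (discBPH.trans S.jBc) (by
      rw [OpenPartialHomeomorph.trans_source, discBPH_source, univ_inter, jBc, openEmbeddingChart_source,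
        preimage_univ])
    (contMDiffOn_trans_of contMDiffOn_discBPH (contMDiffOn_openEmbeddingChart S.hjB S.hjBo))
    (contMDiffOn_trans_symm_of contMDiffOn_discBPH_symm (contMDiffOn_openEmbeddingChart_symm S.hjB S.hjBo))
    (ContinuousLinearEquiv.refl ℝ _)
  exact h

/-- `c₂ = (affineChart 2).symm` is a smooth embedding `ℝ⁴ → ℂℙ²`. [folklore] -/
theorem isSmoothEmbedding_cTwo : Manifold.IsSmoothEmbedding 𝓘(ℝ, 𝔼 4) (𝓡 4) ∞
    ((ComplexProjectiveSpace.affineChart (n := 2) 2 :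
      OpenPartialHomeomorph ComplexProjectivePlane (𝔼 4)).symm) := by
  set e := (ComplexProjectiveSpace.affineChart (n := 2) 2 : OpenPartialHomeomorph ComplexProjectivePlane (𝔼 4))
  refine isSmoothEmbedding_of_openPartialHomeomorph (I := 𝓘(ℝ, 𝔼 4)) (J := 𝓡 4) (n := ∞) e.symm
    (by rw [OpenPartialHomeomorph.symm_source]; rfl) ?_ ?_ (ContinuousLinearEquiv.refl ℝ _)
  · exact (contMDiff_affineChart_symm' 2).contMDiffOn
  · rw [OpenPartialHomeomorph.symm_symm, OpenPartialHomeomorph.symm_target]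
    exact fun y hy => (contMDiffAt_affineChart hy).contMDiffWithinAt

/-- The second embedding `e₂ = j ∘ eTwo` on `ℂℙ² ∖ {q}`, as a partial homeomorphism from the
open subset. [folklore] -/
def eTwoLoc (U : TopologicalSpace.Opens ComplexProjectivePlane) (hU : Nonempty U) :
    OpenPartialHomeomorph U ν.Dissolve :=
  (U.openPartialHomeomorphSubtypeCoe hU).trans (eTwoPH.trans S.jc)

/-- The disc of `ℂℙ²` centred at `q`: the inverse of the third affine chart. [folklore] -/
def cTwo : 𝔼 4 → ComplexProjectivePlane :=
  (ComplexProjectiveSpace.affineChart (n := 2) 2 : OpenPartialHomeomorph ComplexProjectivePlane (𝔼 4)).symm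

/-- `c₂ 0 = q`. [folklore] -/
theorem cTwo_zero : cTwo 0 = qPt := affineChart_two_symm_zero

/-- The punctured second summand is `ℂℙ² ∖ {q}`. [folklore] -/
theorem mem_puncture_cTwo_iff (y : ComplexProjectivePlane) : y ∈ puncture cTwo ↔ y ≠ qPt := by
  rw [mem_puncture, cTwo_zero]

/-- Nonemptiness of `ℂℙ² ∖ {q}`. [folklore] -/
instance nonempty_puncture_cTwo : Nonempty (puncture cTwo) :=
  ⟨⟨GEinv (Φ₂ 0), by rw [mem_puncture_cTwo_iff]; exact GEinv_ne_qPt (Φ₂_not_mem_sFibre 0)⟩⟩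

/-- **The second embedding** `ℂℙ² ∖ {q} → M`: `j ∘ eTwo`. [folklore] -/
def eTwoM (y : puncture cTwo) : ν.Dissolve := S.j (eTwo y)

/-- The second embedding as a globally defined partial homeomorphism. [folklore] -/
def eTwoMPH : OpenPartialHomeomorph (puncture cTwo) ν.Dissolve := S.eTwoLoc (puncture cTwo) inferInstance

omit [T2Space Y] in
/-- The source of `eTwoMPH` is everything. [folklore] -/
theorem eTwoMPH_source : S.eTwoMPH.source = univ := by
  rw [eTwoMPH, eTwoLoc, OpenPartialHomeomorph.trans_source,
    TopologicalSpace.Opens.openPartialHomeomorphSubtypeCoe_source, univ_inter, OpenPartialHomeomorph.trans_source,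
    eTwoPH_source, jc, openEmbeddingChart_source, preimage_univ, inter_univ]
  exact eq_univ_of_forall fun y => (mem_puncture_cTwo_iff _).1 y.2

omit [T2Space Y] in
/-- `eTwoMPH` acts as `eTwoM`. [folklore] -/
theorem eTwoMPH_apply (y : puncture cTwo) : S.eTwoMPH y = S.eTwoM y := rfl

omit [T2Space Y] in
/-- **The second embedding is a smooth embedding.** [folklore] -/
theorem isSmoothEmbedding_eTwoM : Manifold.IsSmoothEmbedding (𝓡 4) (𝓡 4) ∞ S.eTwoM := by
  have h := isSmoothEmbedding_of_openPartialHomeomorph (I := 𝓡 4) (J := 𝓡 4) (n := ∞) S.eTwoMPH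
    S.eTwoMPH_source
    (contMDiffOn_trans_of (contMDiffOn_openPartialHomeomorphSubtypeCoe _ _)
      (contMDiffOn_trans_of contMDiffOn_eTwoPH (contMDiffOn_openEmbeddingChart S.hj S.hjo)))
    (contMDiffOn_trans_symm_of (contMDiffOn_openPartialHomeomorphSubtypeCoe_symm _ _)
      (contMDiffOn_trans_symm_of contMDiffOn_eTwoPH_symm (contMDiffOn_openEmbeddingChart_symm S.hj S.hjo)))
    (ContinuousLinearEquiv.refl ℝ _)
  exact h

omit [T2Space Y] in
/-- **The range of the second embedding** is `j (rangeTwo)`. [folklore] -/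
theorem range_eTwoM : range S.eTwoM = S.j '' rangeTwo := by
  ext m
  constructor
  · rintro ⟨y, rfl⟩
    refine ⟨eTwo y, ?_, rfl⟩
    rw [rangeTwo, ← image_eTwo]
    exact ⟨y, (mem_puncture_cTwo_iff _).1 y.2, rfl⟩
  · rintro ⟨v, hv, rfl⟩
    rw [rangeTwo, ← image_eTwo] at hv
    obtain ⟨y, hy, rfl⟩ := hv
    exact ⟨⟨y, (mem_puncture_cTwo_iff _).2 hy⟩, rfl⟩

omit [T2Space Y] in
/-- The range of the second embedding is open. [folklore] -/
theorem isOpen_range_eTwoM : IsOpen (range S.eTwoM) := by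
  rw [range_eTwoM, rangeTwo]
  exact (IsOpenEmbedding.mk S.hj.isEmbedding S.hjo).isOpenMap _ (isOpen_bdRad_lt _)

omit [T2Space Y] in
/-- A point `j v` in the range of `inl` has `v ∈ rangeOne`. [folklore] -/
theorem mem_rangeOne_of_mem_range_inl {v : Model} (hv : S.j v ∈ range ν.dissolveData.inl) : v ∈ rangeOne := by
  obtain ⟨a, ha⟩ := hv
  obtain ⟨b, hb, rfl, -⟩ := (S.hjrel a v).1 ha
  exact toModel_mem_rangeOne_of_norm_snd (lt_trans (by norm_num) hb)

/-- The two ranges in `M` are disjoint. [folklore] -/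
theorem disjoint_range : Disjoint (range S.eOne) (range S.eTwoM) := by
  rw [Set.disjoint_left]
  intro m h1 h2
  rw [range_eTwoM] at h2
  obtain ⟨v, hv, rfl⟩ := h2
  rcases (S.mem_range_eOne_iff _).1 h1 with h | ⟨v', hv', hvv⟩
  · exact Set.disjoint_left.1 disjoint_rangeOne_rangeTwo (S.mem_rangeOne_of_mem_range_inl h) hv
  · rw [S.hj.isEmbedding.injective hvv] at hv'
    exact Set.disjoint_left.1 disjoint_rangeOne_rangeTwo hv' hv

/-- The middle sphere misses the first range. [folklore] -/
theorem neck_zero_not_mem_range_eOne (θ : sphere (0 : 𝔼 4) 1) : S.j (neckV (θ, 0)) ∉ range S.eOne := by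
  intro h
  have hnot := liftDisc_smul_not_mem (norm_eq_of_mem_sphere θ)
  rw [neckV_zero] at h
  rcases (S.mem_range_eOne_iff _).1 h with h | ⟨v', hv', hvv⟩
  · exact hnot.1 (S.mem_rangeOne_of_mem_range_inl h)
  · rw [S.hj.isEmbedding.injective hvv] at hv'; exact hnot.1 hv'

omit [T2Space Y] in
/-- The middle sphere misses the second range. [folklore] -/
theorem neck_zero_not_mem_range_eTwoM (θ : sphere (0 : 𝔼 4) 1) : S.j (neckV (θ, 0)) ∉ range S.eTwoM := by
  rw [range_eTwoM, neckV_zero]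
  rintro ⟨v, hv, hvv⟩
  rw [S.hj.isEmbedding.injective hvv] at hv
  exact (liftDisc_smul_not_mem (norm_eq_of_mem_sphere θ)).2 hv

/-- **The complement of the two ranges is the middle sphere.** [folklore] -/
theorem exists_neck_zero_eq {m : ν.Dissolve} (h1 : m ∉ range S.eOne) (h2 : m ∉ range S.eTwoM) :
    ∃ θ : sphere (0 : 𝔼 4) 1, S.j (neckV (θ, 0)) = m := by
  rcases (eq_univ_iff_forall.1 S.hjcov m) with hm | ⟨v, rfl⟩
  · exact absurd ((S.mem_range_eOne_iff m).2 (Or.inl hm)) h1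
  · have hv1 : v ∉ rangeOne := fun hv => h1 ((S.mem_range_eOne_iff _).2 (Or.inr ⟨v, hv, rfl⟩))
    have hv2 : v ∉ rangeTwo := fun hv => h2 (by rw [range_eTwoM]; exact ⟨v, hv, rfl⟩)
    obtain ⟨θ, hθ, rfl⟩ := exists_eq_liftDisc_of_not_mem hv1 hv2
    exact ⟨⟨θ, mem_sphere_zero_iff_norm.2 hθ⟩, by rw [neckV_zero]⟩

include S in
/-- **The assembly lemma: `M` is a connected sum `Y # ℂℙ²`.** [folklore] -/
theorem isConnectedSum [IsManifold (𝓡 4) ∞ Y] :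
    IsConnectedSum (𝓡 4) (𝓡 4) (𝓡 4) Y ComplexProjectivePlane ν.Dissolve := by
  haveI := Fact.mk (@finrank_euclideanSpace_fin ℝ _ 4)
  refine isConnectedSum_of_neck (n := 3) (c₁ := S.cOne) (c₂ := cTwo) (ψ := S.j ∘ neckV)
    (e₁ := S.eOne) (e₂ := S.eTwoM) S.isSmoothEmbedding_cOne isSmoothEmbedding_cTwo
    S.isSmoothEmbedding_neck ?_ S.isSmoothEmbedding_eOne S.isOpen_range_eOne S.isSmoothEmbedding_eTwoM
    S.isOpen_range_eTwoM S.disjoint_range S.neck_zero_not_mem_range_eOne S.neck_zero_not_mem_range_eTwoM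
    (fun m h1 h2 => S.exists_neck_zero_eq h1 h2) (fun θ t ht => ?_) (fun θ t ht => ?_)
  · rw [range_comp]
    exact (IsOpenEmbedding.mk S.hj.isEmbedding S.hjo).isOpenMap _ isOpen_range_neckV
  · have hne : discB (t • (θ : 𝔼 4)) ≠ ToricBlowup.basePt :=
      discB_ne_basePt (smul_ne_zero ht.ne' (ne_zero_of_mem_unit_sphere θ))
    exact ⟨⟨S.jB (discB (t • (θ : 𝔼 4))), S.jB_mem_puncture hne⟩, rfl, by
      rw [S.eOne_jB hne, toModel_ΘB_discB_smul θ ht]; rfl⟩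
  · have hmem : cTwo (t • (θ : 𝔼 4)) ∈ puncture cTwo := by
      rw [mem_puncture]
      intro h
      have := isSmoothEmbedding_cTwo.isEmbedding.injective h
      exact smul_ne_zero ht.ne' (ne_zero_of_mem_unit_sphere θ) this
    exact ⟨⟨cTwo (t • (θ : 𝔼 4)), hmem⟩, rfl, by
      change S.j (eTwo (cTwo (t • (θ : 𝔼 4)))) = S.j (neckV (θ, -t))
      rw [cTwo, eTwo_affine₂_smul' θ ht]⟩

end Embedding

end DissolveSide

end TwoKnot.TubularNbhd

end Literature.Topology.FourManifolds
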